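import Summits.Ventures.HSemireg.HomComplexSupertracePushforward
import Summits.Ventures.HSemireg.HomComplexSigmaQuasiIso
import Summits.Ventures.HSemireg.AmplificationChainSigmaGluableOfSchemeIso
import Literature.AlgebraicGeometry.HodgeTheory.HomComplexUnitPushforward
import HarnessLib

/-!
# Venture HSemireg — `σ_q` of a strictly perfect complex ALONG AN ISOMORPHISM OF THE BASE SCHEME and the invariance of
# Buchweitz–Flenner `I`-semiregularity `IsISemiregularC` under `e_*` / `e^*` (`HomComplex.IsISemiregularC.of_schemeIso`)

research route conditional on HC_CM; not a corollary; Q11.4-sentence-2 already refuted in dim ≥ 3.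

HONEST FRAMING. Kernel bookkeeping on the cell's real carriers (t-7's `HomComplex.sigmaC` / `IsISemiregularC` of `HomComplexSigma.lean`);
nothing about any variety; nothing here says HC, HC_CM or HC_AV is proved. Seat ring2-b06 gen 119: this file CLOSES the banked by-name
support target `HomComplex.IsISemiregularC.of_schemeIso` of crux stmt-HodgeConjecture-19787 (ring2 LEAD 152 ruling L152.5 (R3); the `hσC`
of `AmplificationChainSigmaGluableOfSchemeIso.lean`, seat ring2-b06 gen 118), assembling the pieces (N1) `HomFunctorPushforwardIso`,
(N2) `Literature…HomComplexUnitPushforward`, (N3) `DerivedDescentBaseChange`, (N4) `ComplexAtiyahPushforward`, (N5) `HomComplexSupertracePushforward`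
and `DerivedDescentBaseChangeMul`. Complex-level twin of the tree's module-level `ISemiregularOfSchemeIso.IsISemiregular.of_schemeIso`.

For an isomorphism `e : X₀ ≅ X₁` of `S`-schemes, `e_* = pushforward e.hom.left`, `e_{**} = mapShiftedHom e_*` (bijective on shifted Homs of
complexes, `mapShiftedHom_bijective`), `K ∈ [a, b]` termwise finite locally free on `X₀`, `K' = e_*•K`:
* §1 the two end isomorphisms `e_*•(𝒪_{X₀}[0]) ≅ 𝒪_{X₁}[0]` (`unitSingleIso`), `e_*•(Ω^q_{X₀}[0]) ≅ Ω^q_{X₁}[0]` (`hodgeSingleIso`); (N2), (N3), (N5) in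
  the spelling of this file (`map_unit_comp`, `mapShiftedHom_phi_comp`, `map_inv_comp_supertraceH`);
* §2 **`mapShiftedHom_sigmaC`** — `e_{**}(σ_q^K(x)) = [Q u] ≫ σ_q^{K'}(e_{**} x) ≫ [Q v⁻¹]⟦q+2⟧` (`u`, `v` the end isomorphisms);
* §3 **`IsISemiregularC.pushforward_of_schemeIso`** — `IsISemiregularC X₀ K a b hK J → IsISemiregularC X₁ (e_*•K) a b hK' J` (every class of
  `Ext²(K', K')` is `e_{**}` of a class of `Ext²(K, K)`, and `e_{**}` is injective on the targets), and the converse `…_iff`;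
* §4 **`IsISemiregularC.of_schemeIso`** — the PULL-BACK form, VERBATIM the hypothesis `hσC` of
  `gluableSigmaAdmissible_pullback_of_schemeIso_of_isISemiregularC`: for `e : Y' ≅ Y`, `IsISemiregularC Y E a b hE J →
  IsISemiregularC Y' (e^*E) a b (fun i ↦ (hE i).pullback e.hom.left) J` (`e^* ≅ (e⁻¹)_*` as functors, `pullbackIsoPushforwardInv`, then §3 for
  `e.symm` and t-7's invariance under isomorphism of complexes `isISemiregularC_iff_of_iso`); hence the venture's gluable σ-notion transports:
  **`gluableSigmaAdmissible_pullback_of_schemeIso`** (D2's `hσ`, unconditionally).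

References: R.-O. Buchweitz, H. Flenner, Compositio Math. 137 (2003), Def. 4.1, §5 (I-semiregular) [BuchweitzFlenner2003]; M. Lieblich,
J. Algebraic Geom. 15 (2006), Prop. 2.1.9 [Lieblich2006]; C. A. Weibel (1994), §10.4 [Weibel1994]; R. Hartshorne (1977), II §5 p. 110
[Hartshorne1977]. Bookkeeping along an isomorphism (reading; no printed statement is typed verbatim).
-/

noncomputable section

-- `TopCat.Presheaf`/`Scheme.Modules` are not reducible (as in Mathlib's `AlgebraicGeometry/Modules/Sheaf.lean`).
set_option backward.isDefEq.respectTransparency false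

open CategoryTheory CategoryTheory.Category CategoryTheory.Limits AlgebraicGeometry Opposite
open AlgebraicGeometry.Scheme.Modules DerivedCategory

universe w₀ w₁ u

namespace Summit.Ventures.HSemireg

namespace HomComplex

open Literature.AlgebraicGeometry.Modules Literature.AlgebraicGeometry.Motives
open Literature.AlgebraicGeometry.HodgeTheory (leftIso')

variable {S : Type u} [CommRing S] {X₀ X₁ : Over (Spec (CommRingCat.of S))} (e : X₀ ≅ X₁)

/-! ## §1 The end isomorphisms; (N2), (N3), (N5) in the spelling of this file -/

section Ends

/-- **`e_*•(𝒪_{X₀}[0]) ≅ 𝒪_{X₁}[0]`**: single complexes commute with `e_*•` (Mathlib `singleMapHomologicalComplex`) and `e_*𝒪_{X₀} ≅ 𝒪_{X₁}`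
(`unitPushforwardIso`). [cite: Hartshorne1977, II §5 pp. 109–110 (direct images; reading: bookkeeping along an isomorphism of schemes)] -/
def unitSingleIso :
    ((pushforward e.hom.left).mapHomologicalComplex (ComplexShape.up ℤ)).obj
        ((HomologicalComplex.single X₀.left.Modules (ComplexShape.up ℤ) 0).obj (unitModule X₀.left)) ≅
      (HomologicalComplex.single X₁.left.Modules (ComplexShape.up ℤ) 0).obj (unitModule X₁.left) :=
  (HomologicalComplex.singleMapHomologicalComplex (pushforward e.hom.left) (ComplexShape.up ℤ) 0).app (unitModule X₀.left) ≪≫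
    (HomologicalComplex.single X₁.left.Modules (ComplexShape.up ℤ) 0).mapIso (unitPushforwardIso (leftIso' e)).symm

/-- **`e_*•(Ω^q_{X₀}[0]) ≅ Ω^q_{X₁}[0]`** (`singleMapHomologicalComplex` and `hodgeSheaf.comapIso`).
[cite: Hartshorne1977, II Ex. 5.16 (e) with II Prop. 8.11 (pull-back of differentials; reading: an isomorphism for an isomorphism)] -/
def hodgeSingleIso (q : ℕ) :
    ((pushforward e.hom.left).mapHomologicalComplex (ComplexShape.up ℤ)).obj
        ((HomologicalComplex.single X₀.left.Modules (ComplexShape.up ℤ) 0).obj (hodgeSheaf X₀ q)) ≅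
      (HomologicalComplex.single X₁.left.Modules (ComplexShape.up ℤ) 0).obj (hodgeSheaf X₁ q) :=
  (HomologicalComplex.singleMapHomologicalComplex (pushforward e.hom.left) (ComplexShape.up ℤ) 0).app (hodgeSheaf X₀ q) ≪≫
    (HomologicalComplex.single X₁.left.Modules (ComplexShape.up ℤ) 0).mapIso
      (Literature.AlgebraicGeometry.HodgeTheory.hodgeSheaf.comapIso e q).symm

variable (K : CochainComplex X₀.left.Modules ℤ) (a b : ℤ) [K.IsStrictlyGE a] [K.IsStrictlyLE b]
  (hK : ∀ p, IsFiniteLocallyFree (K.X p))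
  (hK' : ∀ p, IsFiniteLocallyFree ((((pushforward e.hom.left).mapHomologicalComplex (ComplexShape.up ℤ)).obj K).X p))

/-- **(N2) in this spelling**: `e_*•(unit_K) ≫ τ_K = u ≫ unit_{e_*•K}` (`Literature…single_map_unitPushforwardIso_comp_map_unit`; the venture
and Literature copies of `HomComplex.unit` agree definitionally). [cite: BuchweitzFlenner2003, §2 and Def. 4.1 (the unit of the trace formalism; reading: compatible with an isomorphism of the ambient scheme)] -/
theorem map_unit_comp :
    ((pushforward e.hom.left).mapHomologicalComplex (ComplexShape.up ℤ)).map (unit X₀.left K a b) ≫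
        (homFunctorOverPushforwardIso e K K).hom =
      (unitSingleIso e).hom ≫ unit X₁.left (((pushforward e.hom.left).mapHomologicalComplex (ComplexShape.up ℤ)).obj K) a b := by
  have h := Literature.AlgebraicGeometry.HodgeTheory.single_map_unitPushforwardIso_comp_map_unit (leftIso' e) K a b
  rw [← cancel_epi (unitSingleIso e).inv, Iso.inv_hom_id_assoc]
  simp only [unitSingleIso, Iso.trans_inv, Functor.mapIso_inv, Iso.symm_inv, Iso.app_inv, Category.assoc]
  exact h

/-- **(N5) in this spelling, inverted**: `𝓗om•(K', α_q•⁻¹) ≫ τ⁻¹ ≫ e_*•(Tr•^H_K) = Tr•^H_{K'} ≫ v⁻¹`. [cite: BuchweitzFlenner2003, §4 (trace map; reading: compatible with an isomorphism of the ambient scheme)] -/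
theorem map_inv_comp_supertraceH (q : ℕ) :
    (homFunctor X₁.left (((pushforward e.hom.left).mapHomologicalComplex (ComplexShape.up ℤ)).obj K)).map
          (twistHodgeComplexPushforwardIso e q K).inv ≫
        (homFunctorOverPushforwardIso e K (twistHodgeComplex X₀ q K)).inv ≫
          ((pushforward e.hom.left).mapHomologicalComplex (ComplexShape.up ℤ)).map (supertraceH X₀ K hK q) =
      supertraceH X₁ (((pushforward e.hom.left).mapHomologicalComplex (ComplexShape.up ℤ)).obj K) hK' q ≫ (hodgeSingleIso e q).inv := by
  have h := map_supertraceH_comp e K hK hK' q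
  have h' : ((pushforward e.hom.left).mapHomologicalComplex (ComplexShape.up ℤ)).map (supertraceH X₀ K hK q) ≫ (hodgeSingleIso e q).hom =
      (homFunctorOverPushforwardIso e K (twistHodgeComplex X₀ q K)).hom ≫
        (homFunctor X₁.left (((pushforward e.hom.left).mapHomologicalComplex (ComplexShape.up ℤ)).obj K)).map
            (twistHodgeComplexPushforwardIso e q K).hom ≫
          supertraceH X₁ (((pushforward e.hom.left).mapHomologicalComplex (ComplexShape.up ℤ)).obj K) hK' q := by
    simpa only [hodgeSingleIso, Iso.trans_hom, Functor.mapIso_hom, Iso.symm_hom, Iso.app_hom] using h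
  rw [← Iso.eq_comp_inv] at h'
  rw [h', Category.assoc, Category.assoc, Iso.inv_hom_id_assoc, ← Functor.map_comp_assoc, Iso.inv_hom_id,
    CategoryTheory.Functor.map_id, Category.id_comp]

variable [HasDerivedCategory.{w₀} X₀.left.Modules] [HasDerivedCategory.{w₁} X₁.left.Modules]

/-- **(N3) in this spelling**: `e_{**}(Φ_K(y)) ≫ [Q τ_L]⟦n⟧ = [Q τ_A] ≫ Φ_{e_*•K}(e_{**}(y))` for `y : Q A ⟶ (Q L)⟦n⟧`
(`mapShiftedHom_shiftedHomMap` at the shift-compatible `τ = homFunctorPushforwardIso`). [cite: Weibel1994, §10.4 and Cor. 10.4.7] -/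
theorem mapShiftedHom_phi_comp {A L : CochainComplex X₀.left.Modules ℤ} {n : ℤ} (y : ShiftedHom (Q.obj A) (Q.obj L) n) :
    mapShiftedHom (pushforward e.hom.left) (shiftedHomMap (homFunctor X₀.left K) (homFunctor_isInvertedBy X₀ K a b hK) y) ≫
        (Q.map (homFunctorOverPushforwardIso e K L).hom)⟦n⟧' =
      Q.map (homFunctorOverPushforwardIso e K A).hom ≫
        shiftedHomMap (homFunctor X₁.left (((pushforward e.hom.left).mapHomologicalComplex (ComplexShape.up ℤ)).obj K))
          (homFunctor_isInvertedBy X₁ _ a b hK') (mapShiftedHom (pushforward e.hom.left) y) :=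
  mapShiftedHom_shiftedHomMap (pushforward (leftIso' e).hom) (homFunctor X₀.left K) (homFunctor X₁.left _)
    (homFunctor_isInvertedBy X₀ K a b hK) (homFunctor_isInvertedBy X₁ _ a b hK') (homFunctorPushforwardIso (leftIso' e) K) y

end Ends

/-! ## §2 `σ_q` along `e_{**}` -/

section Sigma

variable (K : CochainComplex X₀.left.Modules ℤ) (a b : ℤ) [K.IsStrictlyGE a] [K.IsStrictlyLE b]
  (hK : ∀ p, IsFiniteLocallyFree (K.X p))
  (hK' : ∀ p, IsFiniteLocallyFree ((((pushforward e.hom.left).mapHomologicalComplex (ComplexShape.up ℤ)).obj K).X p))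
  [HasDerivedCategory.{w₀} X₀.left.Modules] [HasDerivedCategory.{w₁} X₁.left.Modules]

/-- Reassociation across a CAST of the total degree, second shape: `(Y · t) · g = Y · (t ≫ g)` where the INNER composition casts
(`hc : (0 : ℤ) + n = c`) and the outer one is `zero_add c` (companion of t-7's `shiftedHom_comp_mk₀_comp_mk₀_cast`). [folklore] -/
theorem comp_mk₀_cast_comp_mk₀ {D : Type*} [Category D] [HasShift D ℤ] {T₁ T₂ T₃ T₄ : D} {n c : ℤ}
    (Y : ShiftedHom T₁ T₂ n) (t : T₂ ⟶ T₃) (g : T₃ ⟶ T₄) (hc : (0 : ℤ) + n = c) :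
    (Y.comp (ShiftedHom.mk₀ (0 : ℤ) rfl t) hc).comp (ShiftedHom.mk₀ (0 : ℤ) rfl g) (zero_add c) =
      Y.comp (ShiftedHom.mk₀ (0 : ℤ) rfl (t ≫ g)) hc := by
  rw [ShiftedHom.comp_assoc Y (ShiftedHom.mk₀ (0 : ℤ) rfl t) (ShiftedHom.mk₀ (0 : ℤ) rfl g) hc (zero_add 0)
    (by rw [zero_add]; exact hc), ShiftedHom.mk₀_comp_mk₀]

/-- `f ≫ ((U · P) · t) ≫ g⟦c⟧ = ((f ≫ U) · P) · (t ≫ g)` — moving outer degree-`0` factors inside a `sigmaC`-shaped composite whose last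
composition CASTS the degree (`(0 : ℤ) + n = c`). [folklore] -/
theorem comp_sigmaShape_comp {D : Type*} [Category D] [HasShift D ℤ] {A₀ A₁ B M Z Z₀ : D} {n c : ℤ}
    (f : A₀ ⟶ A₁) (U : A₁ ⟶ B) (P : ShiftedHom B M n) (t : M ⟶ Z) (g : Z ⟶ Z₀) (hc : (0 : ℤ) + n = c) :
    f ≫ ((ShiftedHom.mk₀ (0 : ℤ) rfl U).comp P (add_zero n)).comp (ShiftedHom.mk₀ (0 : ℤ) rfl t) hc ≫ (shiftFunctor D c).map g =
      ((ShiftedHom.mk₀ (0 : ℤ) rfl (f ≫ U)).comp P (add_zero n)).comp (ShiftedHom.mk₀ (0 : ℤ) rfl (t ≫ g)) hc := by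
  rw [← ShiftedHom.comp_mk₀ (((ShiftedHom.mk₀ (0 : ℤ) rfl U).comp P (add_zero n)).comp (ShiftedHom.mk₀ (0 : ℤ) rfl t) hc)
    (0 : ℤ) rfl g, comp_mk₀_cast_comp_mk₀, ← ShiftedHom.mk₀_comp (0 : ℤ) rfl f, ← shiftedHom_mk₀_comp_comp,
    ShiftedHom.mk₀_comp_mk₀_assoc]

/-- **`σ_q` along an isomorphism of the base scheme**: for `x ∈ Ext²(K, K) = Hom_D(Q K, (Q K)⟦2⟧)`,
`e_{**}(σ_q^K(x)) = [Q u] ≫ σ_q^{e_*•K}(e_{**}(x)) ≫ [Q v⁻¹]⟦q+2⟧` — the unit by (N2), the middle factor `Φ_K(x·ι•·At^q)` by (N3)+(N4), the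
supertrace by (N5). [cite: BuchweitzFlenner2003, Def. 4.1 (σ = Tr(∗ · exp(−At)); reading: σ_q is intrinsic to (X, K•), hence compatible with an isomorphism of the ambient S-scheme)] -/
theorem mapShiftedHom_sigmaC (q : ℕ) (x : ShiftedHom (Q.obj K) (Q.obj K) (2 : ℤ)) :
    mapShiftedHom (pushforward e.hom.left) (sigmaC X₀ K a b hK q x) =
      Q.map (unitSingleIso e).hom ≫
        sigmaC X₁ (((pushforward e.hom.left).mapHomologicalComplex (ComplexShape.up ℤ)).obj K) a b hK' q
            (mapShiftedHom (pushforward e.hom.left) x) ≫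
          (shiftFunctor _ ((q + 2 : ℕ) : ℤ)).map (Q.map (hodgeSingleIso e q).inv) := by
  -- (N4) and its consequence for `Φ`
  have hy : mapShiftedHom (pushforward e.hom.left) (extMulAtiyahPower X₀ K q x) =
      (extMulAtiyahPower X₁ (((pushforward e.hom.left).mapHomologicalComplex (ComplexShape.up ℤ)).obj K) q
        (mapShiftedHom (pushforward e.hom.left) x)).comp
          (ShiftedHom.mk₀ (0 : ℤ) rfl (Q.map (twistHodgeComplexPushforwardIso e q K).inv)) (zero_add _) := by
    rw [← mapShiftedHom_extMulAtiyahPower_comp e K q x, shiftedHom_comp_mk₀_comp_mk₀_cast _ _ _ (zero_add _), ← Functor.map_comp,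
      Iso.hom_inv_id, CategoryTheory.Functor.map_id, ShiftedHom.comp_mk₀_id]
  -- (N3), solved for `e_{**}(Φ_K(y))`
  have hΦ : mapShiftedHom (pushforward e.hom.left) (phiMulAtiyahPower X₀ K a b hK q x) =
      Q.map (homFunctorOverPushforwardIso e K K).hom ≫
        (phiMulAtiyahPower X₁ (((pushforward e.hom.left).mapHomologicalComplex (ComplexShape.up ℤ)).obj K) a b hK' q
            (mapShiftedHom (pushforward e.hom.left) x) ≫
          (shiftFunctor _ ((q : ℤ) + 2)).map (Q.map ((homFunctor X₁.left _).map (twistHodgeComplexPushforwardIso e q K).inv))) ≫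
        (shiftFunctor _ ((q : ℤ) + 2)).map (Q.map (homFunctorOverPushforwardIso e K (twistHodgeComplex X₀ q K)).inv) := by
    have h3 := mapShiftedHom_phi_comp e K a b hK hK' (extMulAtiyahPower X₀ K q x)
    rw [← cancel_mono ((shiftFunctor _ ((q : ℤ) + 2)).map (Q.map (homFunctorOverPushforwardIso e K (twistHodgeComplex X₀ q K)).hom)),
      Category.assoc, Category.assoc, ← Functor.map_comp, ← Functor.map_comp, Iso.inv_hom_id, CategoryTheory.Functor.map_id,
      CategoryTheory.Functor.map_id, Category.comp_id, phiMulAtiyahPower, h3, hy, shiftedHomMap_comp_mk₀, ShiftedHom.comp_mk₀]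
    rfl
  -- (N2) and (N5) after `Q`
  have h2 : Q.map (((pushforward e.hom.left).mapHomologicalComplex (ComplexShape.up ℤ)).map (unit X₀.left K a b)) ≫
      Q.map (homFunctorOverPushforwardIso e K K).hom =
      Q.map (unitSingleIso e).hom ≫ Q.map (unit X₁.left (((pushforward e.hom.left).mapHomologicalComplex (ComplexShape.up ℤ)).obj K) a b) := by
    rw [← Functor.map_comp, ← Functor.map_comp, map_unit_comp e K a b]
  have h5 : (shiftFunctor _ ((q : ℤ) + 2)).map (Q.map ((homFunctor X₁.left _).map (twistHodgeComplexPushforwardIso e q K).inv)) ≫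
      (shiftFunctor _ ((q : ℤ) + 2)).map (Q.map (homFunctorOverPushforwardIso e K (twistHodgeComplex X₀ q K)).inv) ≫
        (shiftFunctor _ ((q : ℤ) + 2)).map (Q.map (((pushforward e.hom.left).mapHomologicalComplex (ComplexShape.up ℤ)).map
          (supertraceH X₀ K hK q))) =
      (shiftFunctor _ ((q : ℤ) + 2)).map (Q.map (supertraceH X₁ (((pushforward e.hom.left).mapHomologicalComplex
          (ComplexShape.up ℤ)).obj K) hK' q)) ≫
        (shiftFunctor _ ((q : ℤ) + 2)).map (Q.map (hodgeSingleIso e q).inv) := by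
    simp only [← Functor.map_comp, map_inv_comp_supertraceH e K hK hK' q]
  -- assemble
  rw [sigmaC, sigmaC, mapShiftedHom_comp, mapShiftedHom_comp, unitQ, unitQ, mapShiftedHom_mk₀, mapShiftedHom_mk₀, comp_sigmaShape_comp]
  refine shiftedHom_comp_mk₀_congr _ _ _ _ _ ?_
  rw [ShiftedHom.mk₀_comp, ShiftedHom.mk₀_comp, hΦ]
  simp only [Functor.map_comp, Category.assoc]
  rw [reassoc_of% h2, h5]

end Sigma

/-! ## §3 `IsISemiregularC` along `e_*` -/

section Pushforward

variable (K : CochainComplex X₀.left.Modules ℤ) (a b : ℤ) [K.IsStrictlyGE a] [K.IsStrictlyLE b]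
  (hK : ∀ p, IsFiniteLocallyFree (K.X p))
  (hK' : ∀ p, IsFiniteLocallyFree ((((pushforward e.hom.left).mapHomologicalComplex (ComplexShape.up ℤ)).obj K).X p))
  [HasDerivedCategory.{w₀} X₀.left.Modules] [HasDerivedCategory.{w₁} X₁.left.Modules]

/-- **Buchweitz–Flenner `I`-semiregularity of a strictly perfect complex is preserved by `e_*` for an isomorphism `e` of `S`-schemes**:
every `x' ∈ Ext²(e_*•K, e_*•K)` is `e_{**} x` (`mapShiftedHom_surjective`), and `σ_q^{e_*•K}(e_{**} x) = σ_q^{e_*•K}(e_{**} y)` for all `q ∈ J`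
gives `e_{**}(σ_q^K x) = e_{**}(σ_q^K y)` (`mapShiftedHom_sigmaC`), hence `σ_q^K x = σ_q^K y` (`mapShiftedHom_injective`), hence `x = y`.
[cite: BuchweitzFlenner2003, Def. 4.1 and §5 (I-semiregular; reading: a property of (X, K•) up to isomorphism of the ambient S-scheme)] -/
theorem IsISemiregularC.pushforward_of_schemeIso {J : Set ℕ} (h : IsISemiregularC X₀ K a b hK J) :
    IsISemiregularC X₁ (((pushforward e.hom.left).mapHomologicalComplex (ComplexShape.up ℤ)).obj K) a b hK' J := by
  intro x' y' hxy
  obtain ⟨x, rfl⟩ := mapShiftedHom_surjective (pushforward e.hom.left) K K 2 x'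
  obtain ⟨y, rfl⟩ := mapShiftedHom_surjective (pushforward e.hom.left) K K 2 y'
  have hxy' : x = y := h (funext fun q => by
    have hq := congr_fun hxy q
    dsimp only at hq ⊢
    apply mapShiftedHom_injective (pushforward e.hom.left)
    rw [mapShiftedHom_sigmaC e K a b hK hK', mapShiftedHom_sigmaC e K a b hK hK', hq])
  rw [hxy']

/-- The converse: classes upstairs are tested downstairs. [cite: BuchweitzFlenner2003, §5 (I-semiregular)] -/
theorem IsISemiregularC.of_pushforward_of_schemeIso {J : Set ℕ}
    (h : IsISemiregularC X₁ (((pushforward e.hom.left).mapHomologicalComplex (ComplexShape.up ℤ)).obj K) a b hK' J) :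
    IsISemiregularC X₀ K a b hK J := by
  intro x y hxy
  apply mapShiftedHom_injective (pushforward e.hom.left)
  refine h (funext fun q => ?_)
  have hq := congrArg (mapShiftedHom (pushforward e.hom.left)) (congr_fun hxy q)
  dsimp only at hq ⊢
  rw [mapShiftedHom_sigmaC e K a b hK hK', mapShiftedHom_sigmaC e K a b hK hK', cancel_epi] at hq
  exact (cancel_mono _).1 hq

/-- **`IsISemiregularC X₀ K ↔ IsISemiregularC X₁ (e_*•K)`.** [cite: BuchweitzFlenner2003, §5 (I-semiregular)] -/
theorem isISemiregularC_pushforward_iff (J : Set ℕ) :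
    IsISemiregularC X₁ (((pushforward e.hom.left).mapHomologicalComplex (ComplexShape.up ℤ)).obj K) a b hK' J ↔
      IsISemiregularC X₀ K a b hK J :=
  ⟨IsISemiregularC.of_pushforward_of_schemeIso e K a b hK hK', IsISemiregularC.pushforward_of_schemeIso e K a b hK hK'⟩

end Pushforward

/-! ## §4 The pull-back form (`hσC` verbatim) and the gluable σ-notion -/

section Pullback

variable {Y Y' : Over (Spec (CommRingCat.of S))} (e : Y' ≅ Y)

/-- **`e^* ≅ (e⁻¹)_*`** as functors `Mod 𝒪_Y ⥤ Mod 𝒪_{Y'}` for an isomorphism `e : Y' ≅ Y` of `S`-schemes (both are left adjoint to `e_*`: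
Mathlib `pullbackPushforwardAdjunction` and the tree's `pushforwardEquivOfIso`; `Adjunction.leftAdjointUniq`). The `ℂ`-scheme case is
`Summit.Ventures.HSemireg.pullbackIsoPushforwardInv` (`ExtRankOfSchemeIso.lean`). [cite: Hartshorne1977, II §5 p. 110 (f^* ⊣ f_*)] -/
def pullbackIsoPushforwardInvOver : Scheme.Modules.pullback e.hom.left ≅ pushforward e.inv.left :=
  Adjunction.leftAdjointUniq (Scheme.Modules.pullbackPushforwardAdjunction e.hom.left)
    (pushforwardEquivOfIso (leftIso' e)).symm.toAdjunction

variable [HasDerivedCategory.{w₀} Y.left.Modules] [HasDerivedCategory.{w₁} Y'.left.Modules]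

/-- **`HomComplex.IsISemiregularC.of_schemeIso`** (the banked by-name support target; VERBATIM the `hσC` of
`gluableSigmaAdmissible_pullback_of_schemeIso_of_isISemiregularC`, for any derived-category instances): Buchweitz–Flenner joint injectivity
of `(σ_q)_{q ∈ J}` transports along pull-back by an isomorphism `e : Y' ≅ Y` of `S`-schemes — `e^*E ≅ (e⁻¹)_*E` termwise
(`pullbackIsoPushforwardInvOver`), §3 for `e.symm`, and invariance under isomorphism of complexes (`isISemiregularC_iff_of_iso`).
[cite: BuchweitzFlenner2003, Def. 4.1 and §5 (I-semiregular; reading: a property of (X, K•) up to isomorphism of the ambient S-scheme)] -/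
theorem IsISemiregularC.of_schemeIso (E : CochainComplex Y.left.Modules ℤ) (a b : ℤ) [E.IsStrictlyGE a] [E.IsStrictlyLE b]
    (hE : ∀ i, IsFiniteLocallyFree (E.X i)) (J : Set ℕ) (h : IsISemiregularC Y E a b hE J) :
    IsISemiregularC Y' (((Scheme.Modules.pullback e.hom.left).mapHomologicalComplex (ComplexShape.up ℤ)).obj E) a b
      (fun i => (hE i).pullback e.hom.left) J := by
  have hpush := IsISemiregularC.pushforward_of_schemeIso e.symm E a b hE
    (fun i => (hE i).pushforward_of_iso (leftIso' e.symm)) h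
  exact (isISemiregularC_iff_of_iso Y' a b (fun i => (hE i).pullback e.hom.left)
    (fun i => (hE i).pushforward_of_iso (leftIso' e.symm))
    ((NatIso.mapHomologicalComplex (pullbackIsoPushforwardInvOver e) (ComplexShape.up ℤ)).app E) J).2 hpush

end Pullback

end HomComplex

/-! ## §5 The venture's gluable σ-notion transports along isomorphisms of `ℂ`-schemes (D2's `hσ`, unconditionally) -/

open Literature.AlgebraicGeometry.Motives Literature.AlgebraicGeometry.KTheory


/-- **The gluable σ-admissibility notion is invariant under pull-back by isomorphisms of `ℂ`-schemes** on bounded complexes of vector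
bundles — the `hσ` of road b02's `twistedDoor_respectsIso_of_sigmaPullback`, now UNCONDITIONAL: gen 118's reduction
`gluableSigmaAdmissible_pullback_of_schemeIso_of_isISemiregularC` fed with `HomComplex.IsISemiregularC.of_schemeIso`.
[cite: BuchweitzFlenner2003, Def. 4.1 and §5 (I-semiregular)] [cite: Lieblich2006, Prop. 2.1.9] -/
theorem gluableSigmaAdmissible_pullback_of_schemeIso :
    ∀ (n : ℕ) ⦃Y Y' : SchemeOver ℂ⦄ (e : Y' ≅ Y) (I : Finset ℕ) (E : CochainComplex Y.left.Modules ℤ),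
      IsBoundedVBComplex E → gluableSigmaAdmissible n Y I E →
        gluableSigmaAdmissible n Y' I (((Scheme.Modules.pullback e.hom.left).mapHomologicalComplex _).obj E) :=
  gluableSigmaAdmissible_pullback_of_schemeIso_of_isISemiregularC fun Y Y' e E a b _ _ hE J => by
    letI := HasDerivedCategory.standard Y.left.Modules
    letI := HasDerivedCategory.standard Y'.left.Modules
    exact fun h => HomComplex.IsISemiregularC.of_schemeIso e E a b hE J h

end Summit.Ventures.HSemireg

end
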